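import Literature.AnabelianGeometry.SemiGraphs.GraphCoveringConnected
import Literature.AnabelianGeometry.SemiGraphs.GraphCoveringSections
import Literature.AnabelianGeometry.SemiGraphs.CoverticialIndexLemma
import Literature.AnabelianGeometry.SemiGraphs.GraphOfAnabelioidsGalois
import Literature.AnabelianGeometry.Anabelioids.TrivialObjectCard
import Mathlib.CategoryTheory.Galois.Prorepresentability

/-!
# [SemiAnbd] Proposition 2.6, edge case: the index count from the cyclic coverings (p. 29)

Mochizuki, *Semi-graphs of anabelioids*, Publ. RIMS **42** (2006) 221–322, §2, proof of
Proposition 2.6, p. 29 [cite: MochizukiSemiAnbd2006, Prop. 2.6 p.29]: "by using the loop `L` of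
`ℍ` constituted by `e_a`, `e_b`, we may construct a finite graph-covering of degree `M`, `𝔾′ → 𝔾`,
which is trivial over `𝕂`, but connected over `L`.  Then considering the actions of `Π_ℍ`, `Π_𝕂` on
the corresponding finite `Π_𝒢`-set yields a contradiction."

This file assembles that argument for the cyclic coverings `𝔾_M → 𝔾` twisted along a branch `b₀`
whose edge does not lie in `𝕂` (`CyclicCovering.lean`), GIVEN that they are connected over `ℍ`
(hypothesis `hconn`; it holds when `ℍ` is connected and contains the edge of `b₀` together with a
second, coverticial, edge — the combinatorial statement "connected over `L`", proved separately):
`relIndex_conj_piK_piH_eq_zero_of_cyclicCovers` — for every `g ∈ Π_𝒢`,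
`[Π_ℍ : Π_ℍ ∩ g Π_𝕂 g⁻¹] = ∞` (`relIndex = 0`), in the notation of `proposition_2_6`
(`Coverticial.lean`: `Π_ℍ`, `Π_𝕂` the images of `piHToPi`, the basepoints related by `α`).
Ingredients: the covering object `A_M = coveringObj` of `B(𝒢)` (`GraphCoveringObject.lean`); its
fibre `S = F(A_M,w)` has `M` points (`TrivialObjectCard.lean`, `card_vertexFiber_cyclicCoverHom`);
`Π_ℍ` acts transitively on `S` (`A_M|_ℍ` is connected, `GraphCoveringConnected.lean`, and `B(𝒢_ℍ)`
is Galois with fibre functor `ρ_w ⋙ F`, `GraphOfAnabelioidsGalois.lean`); `Π_𝕂` — hence each of its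
conjugates — acts trivially (`GraphCoveringSections.lean`); so `[Π_ℍ : Π_ℍ ∩ gΠ_𝕂g⁻¹] ≥ M` for
all `M` (`CoverticialIndexLemma.lean`).  Proof-only, no definitions.
-/

namespace Literature.AnabelianGeometry.SemiGraphs

namespace SemiGraphOfAnabelioids

open CategoryTheory CategoryTheory.Limits CategoryTheory.PreGaloisCategory
open Literature.AnabelianGeometry.Anabelioids
open scoped Pointwise

universe v₁ u₁ u

variable (𝒢 : SemiGraphOfAnabelioids.{v₁, u₁, u})

/-- **The edge-case count of [SemiAnbd] Prop. 2.6 (p. 29)**: let `ℍ`, `𝕂 ⊆ 𝔾` be sub-semi-graphs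
with `ℍ` connected, `b₀` a branch whose edge is not in `𝕂`, and suppose that for every `M ≥ 1`
the cyclic degree-`M` graph-covering `𝔾_M → 𝔾` twisted along `b₀` is connected over `ℍ`.  Then
for all basepoints and every `g ∈ Π_𝒢`, `Π_ℍ ∩ g Π_𝕂 g⁻¹` has infinite index in `Π_ℍ`.
[cite: MochizukiSemiAnbd2006, Prop. 2.6 p.29] -/
theorem relIndex_conj_piK_piH_eq_zero_of_cyclicCovers (hg : 𝒢.graph.IsGraph)
    (H K : 𝒢.graph.Subgraph) (hH : H.toSemiGraph.IsConnected) (b₀ : 𝒢.graph.Branch)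
    (hK₀ : 𝒢.graph.edgeOf b₀ ∉ K.edges)
    (hconn : ∀ M : ℕ, 0 < M →
      (⟨(𝒢.graph.cyclicCoverHom b₀ M).vertexMap ⁻¹' H.verts,
        (𝒢.graph.cyclicCoverHom b₀ M).edgeMap ⁻¹' H.edges⟩ :
          (𝒢.graph.cyclicCover b₀ M).Subgraph).toSemiGraph.IsConnected)
    (w : H.toSemiGraph.Vertex) (F : 𝒢.V w.1 ⥤ FintypeCat.{v₁}) [FiberFunctor F]
    (w' : K.toSemiGraph.Vertex) (F' : 𝒢.V w'.1 ⥤ FintypeCat.{v₁}) [FiberFunctor F']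
    (α : 𝒢.ρ w'.1 ⋙ F' ≅ 𝒢.ρ w.1 ⋙ F) (g : 𝒢.Pi w.1 F) :
    (ConjAct.toConjAct g • ((Aut.autMulEquivOfIso α).toMonoidHom.comp (𝒢.piHToPi K w' F')).range).relIndex
      (𝒢.piHToPi H w F).range = 0 := by
  classical
  refine relIndex_eq_zero_of_transitive_of_trivial (𝒢.piHToPi H w F).range _ fun n => ?_
  -- the cyclic covering of degree `n + 1`, its covering object `A`, the `Π_𝒢`-set `S = F(A_w)`
  haveI : NeZero (n + 1) := ⟨Nat.succ_ne_zero n⟩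
  haveI : ∀ v, Finite ((𝒢.graph.cyclicCoverHom b₀ (n + 1)).VertexFiber v) := fun v =>
    𝒢.graph.finite_vertexFiber_cyclicCoverHom b₀ (n + 1) v
  haveI : ∀ e, Finite ((𝒢.graph.cyclicCoverHom b₀ (n + 1)).EdgeFiber e) := fun e =>
    𝒢.graph.finite_edgeFiber_cyclicCoverHom b₀ (n + 1) e
  let A : 𝒢.BObj := 𝒢.coveringObj (𝒢.graph.cyclicCoverHom_isExcision b₀ (n + 1))
    (𝒢.graph.cyclicCover_isGraph b₀ (n + 1) hg)
  refine ⟨(𝒢.ρ w.1 ⋙ F).obj A, inferInstance, inferInstance, ?_, ?_, ?_⟩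
  · -- `|S| = n + 1`
    have hc : Nat.card (F.obj (∐ fun _ : (𝒢.graph.cyclicCoverHom b₀ (n + 1)).VertexFiber w.1 =>
        ⊤_ (𝒢.V w.1))) = n + 1 :=
      (TrivialObj.card_fiber F).trans (𝒢.graph.card_vertexFiber_cyclicCoverHom b₀ (n + 1) w.1)
    have : n < Nat.card (F.obj (∐ fun _ : (𝒢.graph.cyclicCoverHom b₀ (n + 1)).VertexFiber w.1 =>
        ⊤_ (𝒢.V w.1))) := by rw [hc]; exact n.lt_succ_self
    exact this
  · -- `Π_ℍ` acts transitively: `A|_ℍ` is a connected object of the Galois category `B(𝒢_ℍ)`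
    intro s t
    letI := (𝒢.restrict H).galoisCategory_bObj ⟨hH⟩
    -- (`F` is a fibre functor of `(𝒢_ℍ)_w = 𝒢_w`; the instance is passed across the defeq)
    haveI := @SemiGraphOfAnabelioids.fiberFunctor_ρ (𝒢.restrict H) ⟨hH⟩ w F ‹FiberFunctor F›
    haveI : PreGaloisCategory.IsConnected ((𝒢.restrictFunctor H).obj A) :=
      𝒢.isConnected_restrictFunctor_coveringObj _ _ H (hconn (n + 1) n.succ_pos)
    obtain ⟨σ, hσ⟩ := MulAction.exists_smul_eq (Aut ((𝒢.restrict H).ρ w ⋙ F))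
      (show ((𝒢.restrict H).ρ w ⋙ F).obj ((𝒢.restrictFunctor H).obj A) from s)
      (show ((𝒢.restrict H).ρ w ⋙ F).obj ((𝒢.restrictFunctor H).obj A) from t)
    refine ⟨𝒢.piHToPi H w F σ, ⟨σ, rfl⟩, ?_⟩
    change σ.hom.app ((𝒢.restrictFunctor H).obj A) s = t
    exact hσ
  · -- every conjugate of `Π_𝕂` acts trivially: `Π_𝕂` fixes `F′(A_{w′})` pointwise
    intro k hk s
    obtain ⟨k₀, hk₀, rfl⟩ := (Subgroup.mem_smul_pointwise_iff_exists _ _ _).mp hk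
    obtain ⟨τ, rfl⟩ := hk₀
    have hfix : ∀ x : (𝒢.ρ w.1 ⋙ F).obj A,
        ((Aut.autMulEquivOfIso α).toMonoidHom.comp (𝒢.piHToPi K w' F')) τ • x = x := by
      intro x
      have h1 : τ.hom.app ((𝒢.restrictFunctor K).obj A) (α.inv.app A x) = α.inv.app A x :=
        𝒢.autApp_eq_cyclicCover hg b₀ (n + 1) K hK₀ w' F' τ (α.inv.app A x)
      change α.hom.app A (τ.hom.app ((𝒢.restrictFunctor K).obj A) (α.inv.app A x)) = x
      rw [h1]
      change (α.inv.app A ≫ α.hom.app A) x = x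
      rw [Iso.inv_hom_id_app]
      rfl
    rw [ConjAct.smul_def, ConjAct.ofConjAct_toConjAct, mul_smul, mul_smul, hfix, smul_inv_smul]

end SemiGraphOfAnabelioids

end Literature.AnabelianGeometry.SemiGraphs
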